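import Literature.NumberTheory.Automorphic.GL2CEquivariantPrimitive
import Literature.NumberTheory.Automorphic.GL2CESHEval
import HarnessLib

/-!
# The equivariant primitive of a smooth cochain is smooth

In the vocabulary of `GL2CEquivariantPrimitive` (`Mat = M₂(ℂ)`, `Inv`, `IsCochain`, `primitive`):
if the closed equivariant cochain `f : 𝔭₀ → Fun(GL₂(ℂ), V)` has `C^∞` components `M ↦ f X M` on
`Inv` (e.g. the Eichler–Shimura–Harder cochain, `GL2CESH.FamilyData.contDiffOn_family`), then its
primitive `F = primitive f` is `C^∞` on `Inv` (`contDiffOn_primitive_infty`).  Indeed `F` is `C¹`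
with `DF(M)(W) = f (htPart (M⁻¹ W)) (M)` (`fderiv_primitive_apply`), and the right-hand side is
`∑_j xcoord (htPart (M⁻¹ W)) j • f (x_j) M` — smooth in `M` for each `W` — so `DF` is `C^∞`
(`contDiffOn_clm_apply`, the domain being finite-dimensional) and `F` is `C^∞`
(`contDiffOn_infty_iff_fderiv_of_isOpen`).  This is the smoothness of the primitive needed to
differentiate it along the archimedean group and to integrate by parts against cusp forms
(`IsArchSmooth`). [cite: Harder1987, §3.1] [cite: BorelWallach2000, VII §2.2]

Theorems only; no named fact.
-/

noncomputable section

open Matrix Complex Set Filter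
open scoped MatrixGroups ComplexConjugate Matrix.Norms.Operator Topology ContDiff Classical

namespace Literature.NumberTheory.Automorphic

namespace GL2C

open GL2CESHMat GL2CKType

variable {V : Type*} [NormedAddCommGroup V] [NormedSpace ℝ V]

/-- **Matrix inversion is smooth on `Inv`.** [folklore] -/
theorem contDiffOn_nonsing_inv {n : WithTop ℕ∞} : ContDiffOn ℝ n (fun M : Mat => M⁻¹) Inv := by
  intro M hM
  obtain ⟨u, hu⟩ := (Matrix.isUnit_iff_isUnit_det M).2 hM
  have h : ContDiffAt ℝ n Ring.inverse (u : Mat) := contDiffAt_ringInverse ℝ u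
  rw [hu] at h
  have hfun : (fun M : Mat => M⁻¹) = Ring.inverse := funext fun M => Matrix.nonsing_inv_eq_ringInverse M
  rw [hfun]
  exact h.contDiffWithinAt

/-- The coordinate `W ↦ xcoord (htPart (A W)) j` of the `𝔭₀`-part is smooth in `A`, for fixed `W`.
[folklore] -/
theorem contDiff_xcoord_htPart_mul (W : Mat) (j : Fin 3) :
    ContDiff ℝ ∞ fun A : Mat => xcoord (htPart (A * W)) j := by
  -- `A ↦ xcoord (htPart (A W)) j` is real-linear
  let L : Mat →ₗ[ℝ] ℝ :=
    { toFun := fun A => xcoord (htPart (A * W)) j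
      map_add' := fun A B => by
        rw [Matrix.add_mul, htPart_add, ← xcoordLM_apply, map_add]; rfl
      map_smul' := fun r A => by
        rw [Matrix.smul_mul, htPart_smul, ← xcoordLM_apply, map_smul]; rfl }
  exact (LinearMap.toContinuousLinearMap L).contDiff

/-- `f (htPart Z) M = ∑_j xcoord (htPart Z) j • f (x_j) M` (real-linearity of `f`). [folklore] -/
theorem apply_htPart_eq_sum (f : Mat →ₗ[ℝ] (Mat → V)) (Z M : Mat) :
    f (htPart Z) M = ∑ j, (xcoord (htPart Z) j : ℝ) • f (Xmat j) M := by
  conv_lhs => rw [← sum_xcoord_smul_Xmat (isHT_htPart Z)]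
  simp only [Complex.coe_smul, map_sum, LinearMap.map_smul_of_tower, Finset.sum_apply, Pi.smul_apply]

variable [CompleteSpace V] {f : Mat →ₗ[ℝ] (Mat → V)}

/-- **The primitive of a cochain with smooth components is smooth on `Inv`.**
[cite: Harder1987, §3.1] [cite: BorelWallach2000, VII §2.2] -/
theorem contDiffOn_primitive_infty (hf : IsCochain f) (hsmooth : ∀ j : Fin 3, ContDiffOn ℝ ∞ (f (Xmat j)) Inv) :
    ContDiffOn ℝ ∞ (primitive f) Inv := by
  have hu : UniqueDiffOn ℝ Inv := isOpen_Inv.uniqueDiffOn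
  rw [show (∞ : WithTop ℕ∞) = ∞ + 1 from (ENat.coe_top_add_one).symm, contDiffOn_succ_iff_fderiv_apply hu]
  refine ⟨(contDiffOn_primitive hf).differentiableOn (by simp), by simp, fun W => ?_⟩
  have hformula : ∀ M ∈ Inv, fderivWithin ℝ (primitive f) Inv M W =
      ∑ j, (xcoord (htPart (M⁻¹ * W)) j : ℝ) • f (Xmat j) M := fun M hM => by
    rw [fderivWithin_of_isOpen isOpen_Inv hM, ← apply_htPart_eq_sum]
    exact fderiv_primitive_apply hf hM W
  refine ContDiffOn.congr ?_ hformula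
  refine ContDiffOn.sum fun j _ => ContDiffOn.smul ?_ (hsmooth j)
  exact (contDiff_xcoord_htPart_mul W j).comp_contDiffOn contDiffOn_nonsing_inv

/-- The same with any finite smoothness exponent. [folklore] -/
theorem contDiffOn_primitive_of_smooth (hf : IsCochain f) (hsmooth : ∀ j : Fin 3, ContDiffOn ℝ ∞ (f (Xmat j)) Inv)
    {n : ℕ∞} : ContDiffOn ℝ n (primitive f) Inv :=
  (contDiffOn_primitive_infty hf hsmooth).of_le (by exact_mod_cast le_top)

end GL2C

end Literature.NumberTheory.Automorphic

end
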